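import Literature.AnabelianGeometry.EtaleTheta.FrobenioidCyclotomicRigidity
import Mathlib.CategoryTheory.SingleObj
import Mathlib.CategoryTheory.Discrete.Basic
import Mathlib.CategoryTheory.Products.Basic
import Mathlib.Algebra.Field.ZMod
import Mathlib.Algebra.Group.TypeTags.Finite
import Mathlib.Algebra.Group.Subgroup.Finite
import Mathlib.Algebra.Group.Units.Equiv
import Mathlib.Data.Fintype.Prod
import Mathlib.GroupTheory.Index
import Mathlib.GroupTheory.Coset.Card
import HarnessLib

/-!
# [EtTh] §5: the universal closures of the named facts `PreservesThetaSaturated`, `PreservesCyclotomes` (Thm. 5.6), `ThetaFunctionPreserved` (Thm. 5.7) and `LinearlyReachableFromBN` (Prop. 5.5, transport step) are false as typed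

Mochizuki, *The étale theta function and its Frobenioid-theoretic manifestations*, Publ. RIMS **45** (2009), §5:
Prop. 5.5 pp.327–328 (PDF pp.101–102), Thm. 5.6 p.328 (PDF p.102), Thm. 5.7 pp.329–330 (PDF pp.103–104)
[cite: MochizukiEtTh2009, Thm 5.6 p.328 (PDF p.102)].  abc-iut cell, block F (fact-proving wave), seat abc-iut-f-119,
FROZEN FACT-LIST rows **F-0531** `PreservesThetaSaturated` (Thm. 5.6, first clause), **F-0736** `PreservesCyclotomes`
(Thm. 5.6 proof p.328: "`Ψ` preserves '`O^×(−)`'"), **F-0532** `ThetaFunctionPreserved` (Thm. 5.7), **F-0735**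
`LinearlyReachableFromBN` (Prop. 5.5 proof p.328: "linear morphisms `S'' → S` … which induce isomorphisms"); all in
`FrobenioidCyclotomicRigidity.lean` (abc-iut-L2-t4), kernel_closedness = parametrised.  PROOF-ONLY (no `def`, no
instance, no new named fact).

The four rows are SCHEMATA over the DATA-ONLY §5 record `𝔉 : ThetaFrobenioid C D` (`FrobenioidTheta.lean`: "DATA ONLY:
no field asserts a result of §5" — it carries neither the Frobenioid axioms of [FrdI] Def. 1.3 nor any compatibility of
a self-equivalence with the base) and an ARBITRARY self-equivalence `Ψ : C ≌ C` (F-0532 moreover over the one-field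
predicate stub `V : StdThetaPairStub 𝔉`).  Their universal closures — the only 0-ary readings of the rows — are FALSE
in the kernel (`not_forall_preservesThetaSaturated`, `not_forall_linearlyReachableFromBN`,
`not_forall_thetaFunctionPreserved`, `not_forall_preservesCyclotomes`), witnessed at universe `0` by two explicit
degenerate inhabitants of the record:
* toy A (`exists_toyA`): `C := SingleObj (ℤ/2) × Discrete Bool` over `D := Discrete Bool` (base = second projection,
  so `O^×(S) = Aut_C(S) ≅ ℤ/2` for every `S`), `l = 1`, `N = 2`, `(l·Δ_Θ)_{⟨b⟩} := ℤ/(if b then 2 else 1)`,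
  `A_⊚ = A_N = B_N := (⋆, ⟨false⟩)`, all sections trivial, `Π^tp_X := ℤ × ℤ/2` (discrete), `Π^tp_Ÿ := 1`: the copy
  `(⋆, ⟨true⟩)` is `(1,2)`-theta-saturated, `(⋆, ⟨false⟩)` is not (its `(l·Δ_Θ) ⊗ ℤ/2` has one element), NO
  morphism `(⋆,⟨false⟩) → (⋆,⟨true⟩)` exists, and `Ψ := id × swap` exchanges the copies — so
  `¬ PreservesThetaSaturated 𝔉 Ψ` (F-0531), `¬ LinearlyReachableFromBN 𝔉` (F-0735) and, for the stub class
  `V := "the source is the false copy"`, `¬ ThetaFunctionPreserved 𝔉 V Ψ` (F-0532);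
* toy B (`exists_not_preservesCyclotomes`): `C := SingleObj (ℤ/2 × ℤ/2)` over `D := SingleObj (ℤ/2)` via `pr₁`
  (so `O^×(⋆) = μ_2(⋆) = Ker pr₁`), `Ψ :=` the self-equivalence of the coordinate swap: the unit `(1, −1)` goes to
  `(−1, 1) ∉ O^×(⋆)` — so `¬ PreservesCyclotomes 𝔉 Ψ` (F-0736).
By-product for the NV-L2 inhabitation census ("no landed `ThetaFrobenioid` is a closed term", census v1/v2b): the §5
record HAS a closed-term inhabitant (`nonempty_thetaFrobenioid`).

CONSEQUENCE FOR CONSUMERS (plan/FACT-LIST.md R5): the four rows are admissible AT NAMED INSTANCES ONLY; the instance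
forms in the tree are untouched and remain the currency — abc-iut-L2-d4's `ThetaFrobenioid.preservesCyclotomes_of` /
`preservesThetaSaturated_of` (`Discharge/Sec5Thm56.lean`: Thm. 5.6 from a faithful 1-compatible base shadow `Ψbs, eΨ`
of `Ψ` and the transport `aΨ` — exactly the printed inputs "[FrdI], Theorem 3.4, (iv), (v) … Propositions 2.4, 2.6"
that the toys lack), the calibrations of `ThetaFunctionPreserved` (`Discharge/Sec5StdThetaPairStubNonVacuity.lean`:
its content is carried by WHICH class the stub `V` supplies), and `LinearlyReachableFromBN 𝔉` as a NAMED hypothesis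
of the Prop. 5.5 / Thm. 5.6 discharges (`Discharge/Sec5Thm56OfBiKummerData.lean` …; at `ofBiKummerData` it is itself a
schema over the subquotient stub `Q`).
HONEST FRAMING: statements about the TYPED §5 record (any inhabitant), not about the tempered Frobenioid of an actual
curve of [EtTh] Def. 2.5, for which Prop. 5.5 / Thm. 5.6 / Thm. 5.7 are published theorems; typed ≠ proved; no side is
taken on [IUTchIII] Cor. 3.12.
-/

namespace Literature.AnabelianGeometry.EtaleTheta

namespace FrobenioidCyclotomicRigidity

open CategoryTheory

/-! ### Reduction lemmas over an arbitrary §5 datum -/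

section Reductions

universe w v v' u u'

variable {C : Type u} [Category.{v} C] {D : Type u'} [Category.{v'} D] (𝔉 : ThetaFrobenioid.{w} C D)

/-- F-0531 fails as soon as some theta-saturated `S` is moved by `Ψ` to a non-theta-saturated object.
[cite: MochizukiEtTh2009, Thm 5.6 p.328 (PDF p.102)] -/
theorem not_preservesThetaSaturated_of (Ψ : C ≌ C) (S : C) (hS : 𝔉.IsThetaSaturated S)
    (hΨS : ¬ 𝔉.IsThetaSaturated (Ψ.functor.obj S)) : ¬ PreservesThetaSaturated 𝔉 Ψ :=
  fun h => hΨS ((h S).mp hS)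

/-- F-0735 fails as soon as some theta-saturated `S` receives no morphism at all from `B_N`.
[cite: MochizukiEtTh2009, Prop 5.5 proof p.328 (PDF p.102)] -/
theorem not_linearlyReachableFromBN_of (S : C) (hS : 𝔉.IsThetaSaturated S)
    (hempty : IsEmpty (𝔉.BN ⟶ S)) : ¬ LinearlyReachableFromBN 𝔉 := fun h => by
  obtain ⟨φ, -⟩ := h S hS
  exact hempty.elim φ

/-- F-0532 fails as soon as the stub's class contains a pair whose `Ψ`-image it does not contain.
[cite: MochizukiEtTh2009, Thm 5.7 p.329–330 (PDF pp.103–104)] -/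
theorem not_thetaFunctionPreserved_of (V : StdThetaPairStub 𝔉) (Ψ : C ≌ C) {A B : C} (s s' : A ⟶ B)
    (hs : V.IsStdThetaRootFractionPair s s')
    (hΨs : ¬ V.IsStdThetaRootFractionPair (Ψ.functor.map s) (Ψ.functor.map s')) :
    ¬ ThetaFunctionPreserved 𝔉 V Ψ := fun h => hΨs (h s s' hs)

/-- F-0736 fails as soon as `Ψ` maps some element of `μ_N(S)` to a non-base-identity automorphism.
[cite: MochizukiEtTh2009, Thm 5.6 proof p.328 (PDF p.102)] -/
theorem not_preservesCyclotomes_of (Ψ : C ≌ C) (S : C) (u : Aut S) (hu : u ∈ 𝔉.muTorsion S 𝔉.N)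
    (hΨu : 𝔉.base.map (Ψ.functor.map u.hom) ≠ 𝟙 _) : ¬ PreservesCyclotomes 𝔉 Ψ := fun h =>
  hΨu (h S u hu).1.1

/-- Def. 5.4 checked from: every automorphism of `S` is a unit killed by `l·N`, `Aut_C(S) ≃* ℤ/(l·N)`, and the
cardinality clause (b).  [cite: MochizukiEtTh2009, Def 5.4 p.327 (PDF p.101)] -/
theorem isThetaSaturated_of_aut (S : C) (hunit : ∀ α : Aut S, α ∈ 𝔉.units S)
    (hpow : ∀ α : Aut S, α ^ (𝔉.l * (𝔉.N : ℕ)) = 1)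
    (e : Nonempty (Aut S ≃* Multiplicative (ZMod (𝔉.l * (𝔉.N : ℕ)))))
    (hcard : Nat.card (𝔉.lDeltaModN S) = 𝔉.N) : 𝔉.IsThetaSaturated S := by
  have htop : 𝔉.muTorsion S (𝔉.l * (𝔉.N : ℕ)) = ⊤ :=
    eq_top_iff.2 fun α _ => ⟨hunit α, hpow α⟩
  exact ⟨⟨(MulEquiv.subgroupCongr htop).trans (Subgroup.topEquiv.trans (Classical.choice e))⟩, hcard⟩

/-- Packaging of the three toy-A refutations (F-0531, F-0735, F-0532) from their witnesses.
[cite: MochizukiEtTh2009, Thm 5.6 p.328 (PDF p.102)] -/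
theorem refutations_of (Ψ : C ≌ C) (V : StdThetaPairStub 𝔉) (S : C) (hS : 𝔉.IsThetaSaturated S)
    (hΨS : ¬ 𝔉.IsThetaSaturated (Ψ.functor.obj S)) (hempty : IsEmpty (𝔉.BN ⟶ S))
    {A B : C} (s s' : A ⟶ B) (hs : V.IsStdThetaRootFractionPair s s')
    (hΨs : ¬ V.IsStdThetaRootFractionPair (Ψ.functor.map s) (Ψ.functor.map s')) :
    ¬ PreservesThetaSaturated 𝔉 Ψ ∧ ¬ LinearlyReachableFromBN 𝔉 ∧ ¬ ThetaFunctionPreserved 𝔉 V Ψ :=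
  ⟨not_preservesThetaSaturated_of 𝔉 Ψ S hS hΨS, not_linearlyReachableFromBN_of 𝔉 S hS hempty,
    not_thetaFunctionPreserved_of 𝔉 V Ψ s s' hs hΨs⟩

end Reductions

/-! ### Concrete computations in `ℤ/2`, `ℤ/1`, `ℤ × ℤ/2` and the toy categories -/

section Concrete

/-- Every element of `ℤ/2` squares to `1`. [cite: MochizukiEtTh2009, Def 5.4 p.327 (PDF p.101)] -/
theorem mulZMod2_mul_self : ∀ x : Multiplicative (ZMod 2), x * x = 1 := by decide

/-- The coordinate swap moves `(1, −1)` off the kernel of `pr₁`. [cite: MochizukiEtTh2009, Thm 5.6 proof p.328 (PDF p.102)] -/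
theorem fst_prodComm_ne_one :
    (MonoidHom.fst (Multiplicative (ZMod 2)) (Multiplicative (ZMod 2)))
      (MulEquiv.prodComm (1, Multiplicative.ofAdd 1)) ≠ 1 := by decide

/-- `(1, −1)² = 1` in `ℤ/2 × ℤ/2`. [cite: MochizukiEtTh2009, Def 5.4 p.327 (PDF p.101)] -/
theorem one_ofAdd_one_mul_self :
    ((1, Multiplicative.ofAdd 1) : Multiplicative (ZMod 2) × Multiplicative (ZMod 2)) *
      (1, Multiplicative.ofAdd 1) = 1 := by decide

/-- `(ℤ/2) ⊗ ℤ/2` has `2` elements (clause (b) of Def. 5.4 with `N = 2`).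
[cite: MochizukiEtTh2009, Def 5.4 p.327 (PDF p.101)] -/
theorem card_quot_sq_zmod2 :
    Nat.card (Multiplicative (ZMod 2) ⧸
      (powMonoidHom ((2 : ℕ+) : ℕ) : Multiplicative (ZMod 2) →* Multiplicative (ZMod 2)).range) =
      ((2 : ℕ+) : ℕ) := by
  have hr : (powMonoidHom ((2 : ℕ+) : ℕ) :
      Multiplicative (ZMod 2) →* Multiplicative (ZMod 2)).range = ⊥ := by
    rw [Subgroup.eq_bot_iff_forall]
    rintro _ ⟨x, rfl⟩
    rw [powMonoidHom_apply]
    change x ^ 2 = 1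
    rw [pow_two]
    exact mulZMod2_mul_self x
  change Subgroup.index _ = 2
  rw [hr, Subgroup.index_bot, Nat.card_eq_fintype_card, Fintype.card_multiplicative, ZMod.card]

/-- `(ℤ/1) ⊗ ℤ/2` does not have `2` elements. [cite: MochizukiEtTh2009, Def 5.4 p.327 (PDF p.101)] -/
theorem card_quot_sq_zmod1 :
    Nat.card (Multiplicative (ZMod 1) ⧸
      (powMonoidHom ((2 : ℕ+) : ℕ) : Multiplicative (ZMod 1) →* Multiplicative (ZMod 1)).range) ≠
      ((2 : ℕ+) : ℕ) := by
  intro h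
  have hd := Subgroup.card_quotient_dvd_card
    (powMonoidHom ((2 : ℕ+) : ℕ) : Multiplicative (ZMod 1) →* Multiplicative (ZMod 1)).range
  rw [h, Nat.card_eq_fintype_card, Fintype.card_multiplicative, ZMod.card] at hd
  exact absurd (Nat.le_of_dvd Nat.one_pos hd) (by decide)

/-- `[Ker(pr₁ : ℤ × ℤ/2 → ℤ) : 1] = 2` (the toys' "`[Π^tp_Y : Π^tp_Ÿ] = 2`").
[cite: MochizukiEtTh2009, Thm 5.10 (iii) proof p.335 (PDF p.109)] -/
theorem relIndex_bot_ker_fst :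
    (⊥ : Subgroup (Multiplicative ℤ × Multiplicative (ZMod 2))).relIndex
      (MonoidHom.fst (Multiplicative ℤ) (Multiplicative (ZMod 2))).ker = 2 := by
  rw [Subgroup.relIndex_bot_left, MonoidHom.ker_fst,
    Nat.card_congr (Subgroup.prodEquiv (⊥ : Subgroup (Multiplicative ℤ))
      (⊤ : Subgroup (Multiplicative (ZMod 2)))).toEquiv,
    Nat.card_prod, Subgroup.card_bot, Subgroup.card_top, Nat.card_eq_fintype_card,
    Fintype.card_multiplicative, ZMod.card]

/-- The toys' `Π^tp_X := ℤ × ℤ/2` with the discrete topology is a topological group.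
[cite: MochizukiEtTh2009, Lem 5.9 (iv) p.332 (PDF p.106)] -/
theorem toy_isTopologicalGroup_bot :
    @IsTopologicalGroup (Multiplicative ℤ × Multiplicative (ZMod 2)) ⊥ _ := by
  letI : TopologicalSpace (Multiplicative ℤ × Multiplicative (ZMod 2)) := ⊥
  haveI : DiscreteTopology (Multiplicative ℤ × Multiplicative (ZMod 2)) := ⟨rfl⟩
  exact { continuous_mul := continuous_of_discreteTopology, continuous_inv := continuous_of_discreteTopology }

/-- Every subset of the discrete `ℤ × ℤ/2` is open. [cite: MochizukiEtTh2009, Lem 5.9 (iv) p.332 (PDF p.106)] -/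
theorem toy_isOpen_bot (s : Set (Multiplicative ℤ × Multiplicative (ZMod 2))) : @IsOpen _ ⊥ s := by
  letI : TopologicalSpace (Multiplicative ℤ × Multiplicative (ZMod 2)) := ⊥
  haveI : DiscreteTopology (Multiplicative ℤ × Multiplicative (ZMod 2)) := ⟨rfl⟩
  exact isOpen_discrete s

/-- Toy A: automorphism groups of `SingleObj (ℤ/2) × Discrete Bool` are commutative.
[cite: MochizukiEtTh2009, §5 p.322 (PDF p.96)] -/
theorem toyA_aut_comm (S : SingleObj (Multiplicative (ZMod 2)) × Discrete Bool) (α β : Aut S) :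
    α * β = β * α :=
  Aut.ext (Prod.ext
    (show β.hom.1 ≫ α.hom.1 = α.hom.1 ≫ β.hom.1 from
      @mul_comm (Multiplicative (ZMod 2)) _ α.hom.1 β.hom.1)
    (Subsingleton.elim _ _))

/-- Toy A: every automorphism squares to `1`. [cite: MochizukiEtTh2009, Def 5.4 p.327 (PDF p.101)] -/
theorem toyA_aut_mul_self (S : SingleObj (Multiplicative (ZMod 2)) × Discrete Bool) (α : Aut S) :
    α * α = 1 :=
  Aut.ext (Prod.ext
    (show α.hom.1 ≫ α.hom.1 = 𝟙 S.1 from mulZMod2_mul_self (α.hom.1 : Multiplicative (ZMod 2)))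
    (Subsingleton.elim _ _))

/-- Toy A: `Aut_C(S) ≃* ℤ/2` for every object `S` (so every `S` is `μ_2`-saturated, Def. 5.4 (a)).
[cite: MochizukiEtTh2009, Def 5.4 p.327 (PDF p.101)] -/
theorem toyA_nonempty_autEquiv (S : SingleObj (Multiplicative (ZMod 2)) × Discrete Bool) :
    Nonempty (Aut S ≃* Multiplicative (ZMod 2)) :=
  ⟨{ toFun := fun α => (α.hom.1 : Multiplicative (ZMod 2))
     invFun := fun x =>
       { hom := (x, 𝟙 S.2)
         inv := ((x⁻¹ : Multiplicative (ZMod 2)), 𝟙 S.2)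
         hom_inv_id := Prod.ext
           (show (x⁻¹ : Multiplicative (ZMod 2)) * x = 1 from inv_mul_cancel x) (Subsingleton.elim _ _)
         inv_hom_id := Prod.ext
           (show x * (x⁻¹ : Multiplicative (ZMod 2)) = 1 from mul_inv_cancel x) (Subsingleton.elim _ _) }
     left_inv := fun _ => Aut.ext (Prod.ext rfl (Subsingleton.elim _ _))
     right_inv := fun _ => rfl
     map_mul' := fun _ _ => rfl }⟩

/-- Toy A: there is no morphism from the `false` copy to the `true` copy.
[cite: MochizukiEtTh2009, Prop 5.5 proof p.328 (PDF p.102)] -/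
theorem toyA_isEmpty_hom :
    IsEmpty (((SingleObj.star (Multiplicative (ZMod 2)), Discrete.mk false) :
        SingleObj (Multiplicative (ZMod 2)) × Discrete Bool) ⟶
      (SingleObj.star (Multiplicative (ZMod 2)), Discrete.mk true)) :=
  ⟨fun f => Bool.false_ne_true (Discrete.eq_of_hom f.2)⟩

/-- Toy B: automorphism groups of `SingleObj (ℤ/2 × ℤ/2)` are commutative.
[cite: MochizukiEtTh2009, §5 p.322 (PDF p.96)] -/
theorem toyB_aut_comm (S : SingleObj (Multiplicative (ZMod 2) × Multiplicative (ZMod 2))) (α β : Aut S) :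
    α * β = β * α :=
  Aut.ext (show β.hom ≫ α.hom = α.hom ≫ β.hom from
    @mul_comm (Multiplicative (ZMod 2) × Multiplicative (ZMod 2)) _ α.hom β.hom)

end Concrete

/-! ### Toy A: F-0531, F-0735, F-0532 -/

section ToyA

/-- **Toy A** — an inhabitant `𝔉` of the §5 record over `SingleObj (ℤ/2) × Discrete Bool → Discrete Bool`, the
self-equivalence `Ψ := id × swap` and the stub class `V := "source is the false copy"`, with
`¬ PreservesThetaSaturated 𝔉 Ψ` (F-0531), `¬ LinearlyReachableFromBN 𝔉` (F-0735), `¬ ThetaFunctionPreserved 𝔉 V Ψ`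
(F-0532).  [cite: MochizukiEtTh2009, Thm 5.6 p.328 (PDF p.102)] -/
theorem exists_toyA :
    ∃ (𝔉 : ThetaFrobenioid.{0} (SingleObj (Multiplicative (ZMod 2)) × Discrete Bool) (Discrete Bool))
      (Ψ : (SingleObj (Multiplicative (ZMod 2)) × Discrete Bool) ≌
        (SingleObj (Multiplicative (ZMod 2)) × Discrete Bool))
      (V : StdThetaPairStub 𝔉),
      ¬ PreservesThetaSaturated 𝔉 Ψ ∧ ¬ LinearlyReachableFromBN 𝔉 ∧ ¬ ThetaFunctionPreserved 𝔉 V Ψ := by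
  refine ⟨
    { pre :=
        { base := CategoryTheory.Prod.snd _ _
          Mon := fun _ => PUnit, pull := fun _ => 1, pull_id := fun _ _ => rfl, pull_comp := fun _ _ _ => rfl
          div := fun _ => PUnit.unit, degFr := fun _ => 1, div_id := fun _ => rfl, div_comp := fun _ _ => rfl
          degFr_id := fun _ => rfl, degFr_comp := fun _ _ => rfl }
      units_comm := fun S => ⟨⟨fun a b => Subtype.ext (toyA_aut_comm S a.1 b.1)⟩⟩
      biratUnits := fun _ => Multiplicative (ZMod 2)
      unitsToBirat := fun S =>
        { toFun := fun a => (a.1.hom.1 : Multiplicative (ZMod 2))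
          map_one' := rfl
          map_mul' := fun _ _ => rfl }
      unitsToBirat_injective := fun S a b h => Subtype.ext (Aut.ext (Prod.ext h (Subsingleton.elim _ _)))
      unitsPull := fun _ => 1, IsBaseFrobeniusType := ⊤
      lDelta := fun E => Multiplicative (ZMod (cond E.as 2 1))
      lDeltaMap := fun _ => 1
      l := 1, odd_l := odd_one, N := 2
      Acirc := (SingleObj.star _, Discrete.mk false), AN := (SingleObj.star _, Discrete.mk false)
      BN := (SingleObj.star _, Discrete.mk false), sCap := 𝟙 _, sCup := 𝟙 _, base_map_sCap := rfl
      isPreStep_sCap := ⟨rfl, by change IsIso _; infer_instance⟩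
      isPreStep_sCup := ⟨rfl, by change IsIso _; infer_instance⟩
      PiX := Multiplicative ℤ × Multiplicative (ZMod 2), instTopPiX := ⊥, instTopGroupPiX := toy_isTopologicalGroup_bot
      zquot := MonoidHom.fst _ _, zquot_surjective := Prod.fst_surjective
      PiYdd := ⊥, PiYdd_le := bot_le, relindex_PiYdd := relIndex_bot_ker_fst, PiYdd_normal := inferInstance
      isOpen_PiYdd := toy_isOpen_bot _
      ρ := 1, ρ_surjective := fun α => ⟨1, Aut.ext (Subsingleton.elim _ _)⟩, isOpen_ker_ρ := toy_isOpen_bot _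
      strv := 1, sgpCap := 1, sgpCup := 1, K := ZMod 2, constEmb := 1
      constEmb_injective := Function.injective_of_subsingleton _, thetaFn := 1 },
    (CategoryTheory.Equivalence.refl (C := SingleObj (Multiplicative (ZMod 2)))).prod
      (Discrete.equivalence
        { toFun := not, invFun := not, left_inv := Bool.not_not, right_inv := Bool.not_not }),
    ⟨fun {A} _ _ _ => A.2.as = false⟩,
    refutations_of _ _ _ (SingleObj.star _, Discrete.mk true)
      (isThetaSaturated_of_aut _ _ (fun α => ⟨Subsingleton.elim _ _, rfl⟩)
        (fun α => (pow_two α).trans (toyA_aut_mul_self _ α)) (toyA_nonempty_autEquiv _)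
        card_quot_sq_zmod2)
      (fun h => card_quot_sq_zmod1 h.card_lDeltaModN) toyA_isEmpty_hom
      (𝟙 (SingleObj.star _, Discrete.mk false)) (𝟙 _) rfl (fun h => Bool.false_ne_true (Eq.symm h))⟩

/-- By-product (NV-L2 inhabitation census): the §5 record `ThetaFrobenioid` has a closed-term inhabitant (toy A).
[cite: MochizukiEtTh2009, §5 p.322 (PDF p.96)] -/
theorem nonempty_thetaFrobenioid :
    Nonempty (ThetaFrobenioid.{0} (SingleObj (Multiplicative (ZMod 2)) × Discrete Bool) (Discrete Bool)) := by
  obtain ⟨𝔉, -⟩ := exists_toyA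
  exact ⟨𝔉⟩

/-- **F-0531, the universal closure of the row is false** (`¬ ∀ C D 𝔉 Ψ, PreservesThetaSaturated 𝔉 Ψ`, already at
universe `0`): admissible at named instances only (R5); instance form `ThetaFrobenioid.preservesThetaSaturated_of`.
[cite: MochizukiEtTh2009, Thm 5.6 p.328 (PDF p.102)] -/
theorem not_forall_preservesThetaSaturated :
    ¬ ∀ (C : Type) [Category.{0} C] (D : Type) [Category.{0} D] (𝔉 : ThetaFrobenioid.{0} C D) (Ψ : C ≌ C),
        Literature.AnabelianGeometry.EtaleTheta.FrobenioidCyclotomicRigidity.PreservesThetaSaturated 𝔉 Ψ := by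
  intro H
  obtain ⟨𝔉, Ψ, -, h, -, -⟩ := exists_toyA
  exact h (H _ _ 𝔉 Ψ)

/-- **F-0735, the universal closure of the row is false** (`¬ ∀ C D 𝔉, LinearlyReachableFromBN 𝔉`): admissible at
named instances only (R5); it stays a NAMED hypothesis of the Prop. 5.5 / Thm. 5.6 discharges.
[cite: MochizukiEtTh2009, Prop 5.5 proof p.328 (PDF p.102)] -/
theorem not_forall_linearlyReachableFromBN :
    ¬ ∀ (C : Type) [Category.{0} C] (D : Type) [Category.{0} D] (𝔉 : ThetaFrobenioid.{0} C D),
        Literature.AnabelianGeometry.EtaleTheta.FrobenioidCyclotomicRigidity.LinearlyReachableFromBN 𝔉 := by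
  intro H
  obtain ⟨𝔉, -, -, -, h, -⟩ := exists_toyA
  exact h (H _ _ 𝔉)

/-- **F-0532, the universal closure of the row is false** (`¬ ∀ C D 𝔉 V Ψ, ThetaFunctionPreserved 𝔉 V Ψ`):
admissible at named instances only (R5); calibrations in `Discharge/Sec5StdThetaPairStubNonVacuity.lean`.
[cite: MochizukiEtTh2009, Thm 5.7 p.329–330 (PDF pp.103–104)] -/
theorem not_forall_thetaFunctionPreserved :
    ¬ ∀ (C : Type) [Category.{0} C] (D : Type) [Category.{0} D] (𝔉 : ThetaFrobenioid.{0} C D)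
        (V : StdThetaPairStub 𝔉) (Ψ : C ≌ C),
        Literature.AnabelianGeometry.EtaleTheta.FrobenioidCyclotomicRigidity.ThetaFunctionPreserved 𝔉 V Ψ := by
  intro H
  obtain ⟨𝔉, Ψ, V, -, -, h⟩ := exists_toyA
  exact h (H _ _ 𝔉 V Ψ)

end ToyA

/-! ### Toy B: F-0736 -/

section ToyB

/-- **F-0736, instance-level counterexample (toy B)** — an inhabitant `𝔉` of the §5 record over
`SingleObj (ℤ/2 × ℤ/2) → SingleObj (ℤ/2)` (base = `pr₁`, so `O^×(⋆) = μ_2(⋆) = Ker pr₁`) and the self-equivalence `Ψ`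
induced by the coordinate swap, with `¬ PreservesCyclotomes 𝔉 Ψ`: the unit `(1, −1) ∈ μ_2(⋆)` goes to `(−1, 1) ∉ O^×(⋆)`.
[cite: MochizukiEtTh2009, Thm 5.6 proof p.328 (PDF p.102)] -/
theorem exists_not_preservesCyclotomes :
    ∃ (𝔉 : ThetaFrobenioid.{0} (SingleObj (Multiplicative (ZMod 2) × Multiplicative (ZMod 2)))
        (SingleObj (Multiplicative (ZMod 2))))
      (Ψ : SingleObj (Multiplicative (ZMod 2) × Multiplicative (ZMod 2)) ≌
        SingleObj (Multiplicative (ZMod 2) × Multiplicative (ZMod 2))),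
      ¬ PreservesCyclotomes 𝔉 Ψ := by
  refine ⟨
    { pre :=
        { base := (MonoidHom.fst (Multiplicative (ZMod 2)) (Multiplicative (ZMod 2))).toFunctor
          Mon := fun _ => PUnit, pull := fun _ => 1, pull_id := fun _ _ => rfl, pull_comp := fun _ _ _ => rfl
          div := fun _ => PUnit.unit, degFr := fun _ => 1, div_id := fun _ => rfl, div_comp := fun _ _ => rfl
          degFr_id := fun _ => rfl, degFr_comp := fun _ _ => rfl }
      units_comm := fun S => ⟨⟨fun a b => Subtype.ext (toyB_aut_comm S a.1 b.1)⟩⟩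
      biratUnits := fun _ => Multiplicative (ZMod 2) × Multiplicative (ZMod 2)
      unitsToBirat := fun S =>
        { toFun := fun a => (a.1.hom : Multiplicative (ZMod 2) × Multiplicative (ZMod 2))
          map_one' := rfl
          map_mul' := fun _ _ => rfl }
      unitsToBirat_injective := fun S a b h => Subtype.ext (Aut.ext h)
      unitsPull := fun _ => 1, IsBaseFrobeniusType := ⊤
      lDelta := fun _ => PUnit
      lDeltaMap := fun _ => 1
      l := 1, odd_l := odd_one, N := 2, Acirc := SingleObj.star _, AN := SingleObj.star _, BN := SingleObj.star _
      sCap := 𝟙 _, sCup := 𝟙 _, base_map_sCap := rfl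
      isPreStep_sCap := ⟨rfl, by change IsIso _; infer_instance⟩
      isPreStep_sCup := ⟨rfl, by change IsIso _; infer_instance⟩
      PiX := Multiplicative ℤ × Multiplicative (ZMod 2), instTopPiX := ⊥, instTopGroupPiX := toy_isTopologicalGroup_bot
      zquot := MonoidHom.fst _ _, zquot_surjective := Prod.fst_surjective
      PiYdd := ⊥, PiYdd_le := bot_le, relindex_PiYdd := relIndex_bot_ker_fst, PiYdd_normal := inferInstance
      isOpen_PiYdd := toy_isOpen_bot _
      ρ := ((toUnits (G := Multiplicative (ZMod 2))).trans (Units.toAut (Multiplicative (ZMod 2)))).toMonoidHom.comp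
        (MonoidHom.snd (Multiplicative ℤ) (Multiplicative (ZMod 2)))
      ρ_surjective := fun α =>
        ⟨(1, ((toUnits (G := Multiplicative (ZMod 2))).trans (Units.toAut _)).symm α),
          MulEquiv.apply_symm_apply ((toUnits (G := Multiplicative (ZMod 2))).trans (Units.toAut _)) α⟩
      isOpen_ker_ρ := toy_isOpen_bot _
      strv := 1, sgpCap := 1, sgpCup := 1, K := ZMod 2, constEmb := 1
      constEmb_injective := Function.injective_of_subsingleton _, thetaFn := 1 },
    (MulEquiv.prodComm : Multiplicative (ZMod 2) × Multiplicative (ZMod 2) ≃*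
      Multiplicative (ZMod 2) × Multiplicative (ZMod 2)).toSingleObjEquiv,
    not_preservesCyclotomes_of _ _ (SingleObj.star _)
      (Units.toAut (Multiplicative (ZMod 2) × Multiplicative (ZMod 2)) (toUnits (1, Multiplicative.ofAdd 1)))
      ⟨⟨rfl, rfl⟩, (pow_two _).trans (Aut.ext one_ofAdd_one_mul_self)⟩ fst_prodComm_ne_one⟩

/-- **F-0736, the universal closure of the row is false** (`¬ ∀ C D 𝔉 Ψ, PreservesCyclotomes 𝔉 Ψ`): admissible at
named instances only (R5); instance form `ThetaFrobenioid.preservesCyclotomes_of` (from a base shadow of `Ψ`).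
[cite: MochizukiEtTh2009, Thm 5.6 proof p.328 (PDF p.102)] -/
theorem not_forall_preservesCyclotomes :
    ¬ ∀ (C : Type) [Category.{0} C] (D : Type) [Category.{0} D] (𝔉 : ThetaFrobenioid.{0} C D) (Ψ : C ≌ C),
        Literature.AnabelianGeometry.EtaleTheta.FrobenioidCyclotomicRigidity.PreservesCyclotomes 𝔉 Ψ := by
  intro H
  obtain ⟨𝔉, Ψ, h⟩ := exists_not_preservesCyclotomes
  exact h (H _ _ 𝔉 Ψ)

end ToyB

end FrobenioidCyclotomicRigidity

end Literature.AnabelianGeometry.EtaleTheta
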